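import Summits.AnomalousDissipation.AnomalousDissipation.Theorems.MomentParityQuarticGateAxialQuadAxial
import Summits.AnomalousDissipation.AnomalousDissipation.Theorems.MomentParityQuarticGateAxialQuadCore

/-!
# Axial quadratic rigidity — stub S2q `stub_axialQuadRigidity` of line `axis-sectors`
# (crux `MomentParity.QuarticGate`): assembly

For band tests `g` at level `N ≥ 2` and a homogeneous quadratic `P` whose observable is
`AxialObs`-invariant (`L > 2N`) and a Casimir of level-`N` Galerkin–Euler, `∇p(u) = 2α P_N u +
2β curl P_N u` on level-`N` fields. The Hessian blocks `Q a b = Σ hᵢⱼ ĝᵢ(-a) ĝⱼ(-b)ᵀ` satisfy the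
hypotheses of the algebraic core (`…AxialQuadAxial`, `…AxialQuadPol`), which pins them to
`α + β k×` on the diagonal and kills them elsewhere (`…AxialQuadCore`); the coefficient identity
`𝓕(∇p(u))(k) = Σ_b Q_{-k,b} û(b) = α û(k) + β k × û(k)` is then synthesised back, the reality of
`∇p(u)` forcing `α ∈ ℝ`, `β ∈ iℝ`.
-/

namespace Summit.AnomalousDissipation.AnomalousDissipation.Theorems.MomentParityQuarticGate.AxialQuad

open scoped InnerProductSpace ComplexConjugate
open Matrix
open Literature.Analysis.FunctionSpaces Literature.Analysis.FluidPDE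
open Summit.AnomalousDissipation.AnomalousDissipation.Theorems.QuarticGate.Negative

-- `Summit.<Summit>.<Problem>` is the tree's mandated summit-side namespace (CONVENTIONS §2); for this
-- single-conjunct summit the two coincide, so the duplicate is deliberate.
set_option linter.dupNamespace false

noncomputable section

/-! ## The coefficient identity `𝓕(∇p(u))(k) = Σ_b Q_{-k,b} û(b)` -/

section Coefficients

variable {N m : ℕ} (g : Fin m → UnitAddTorus (Fin 3) → EuclideanSpace ℝ (Fin 3))
  (P : MvPolynomial (Fin m) ℝ)

/-- A Hessian block against a vector: `Q_{a,b} y = Σᵢⱼ hᵢⱼ (ĝⱼ(-b)·y) ĝᵢ(-a)`. [folklore] -/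
theorem hessianBlock_mulVec (a b : Fin 3 → ℤ) (y : Fin 3 → ℂ) :
    (∑ i, ∑ j, (((MvPolynomial.pderiv j (MvPolynomial.pderiv i P)).coeff 0 : ℝ) : ℂ) • Matrix.vecMulVec (WithLp.ofLp (tcoef (g i) (-(a)))) (WithLp.ofLp (tcoef (g j) (-(b))))) *ᵥ y = ∑ i, ∑ j, ((((MvPolynomial.pderiv j (MvPolynomial.pderiv i P)).coeff 0 : ℝ) : ℂ) *
      (WithLp.ofLp (tcoef (g j) (-b)) ⬝ᵥ y)) • WithLp.ofLp (tcoef (g i) (-a)) := by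
  rw [Matrix.sum_mulVec]
  refine Finset.sum_congr rfl fun i _ => ?_
  rw [Matrix.sum_mulVec]
  refine Finset.sum_congr rfl fun j _ => ?_
  ext p
  simp only [Matrix.mulVec, dotProduct, Matrix.smul_apply, Matrix.vecMulVec_apply, smul_eq_mul, Pi.smul_apply,
    Finset.mul_sum, Finset.sum_mul]
  exact Finset.sum_congr rfl fun q _ => by ring

/-- **The gradient's coefficients through the blocks**: for band tests `g`, a homogeneous quadratic
`P` and any `u`, `𝓕(∇p(u))(k) = Σ_{b ∈ S*} Q_{-k,b} û(b)`. [folklore] -/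
theorem tcoef_polyGrad_eq_sum_blocks (hg : ∀ i, IsBandTest N (g i)) (hP : P.IsHomogeneous 2)
    (u : Torus.energySpace (Fin 3)) (k : Fin 3 → ℤ) :
    WithLp.ofLp (tcoef (polyGrad g P u) k) =
      ∑ b ∈ (Torus.freqBall N).erase 0, (∑ i, ∑ j, (((MvPolynomial.pderiv j (MvPolynomial.pderiv i P)).coeff 0 : ℝ) : ℂ) • Matrix.vecMulVec (WithLp.ofLp (tcoef (g i) (-(-k)))) (WithLp.ofLp (tcoef (g j) (-(b))))) *ᵥ WithLp.ofLp (coef u b) := by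
  have hGcs : ∀ i, Torus.IsConjSymm (tcoef (g i)) := fun i =>
    isConjSymm_tcoef (hg i).1.continuous.integrable_unitAddTorus
  -- the pairings in coefficients, complex form
  have hπ : ∀ j, ((Torus.pairing u.1 (g j) : ℝ) : ℂ) =
      ∑ b ∈ (Torus.freqBall N).erase 0, WithLp.ofLp (coef u b) ⬝ᵥ WithLp.ofLp (tcoef (g j) (-b)) := by
    intro j
    rw [pairing_eq_sum_coef_of_isBandTest u (hg j), Complex.ofReal_sum]
    exact AxialQuad.pairingSum_eq' neg_mem_freqBall_erase_zero (isConjSymm_coef u) (hGcs j)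
  rw [tcoef_polyGrad_of_isBandTest g P u hg k, WithLp.ofLp_sum]
  simp_rw [hessianBlock_mulVec, neg_neg]
  rw [Finset.sum_comm]
  refine Finset.sum_congr rfl fun i _ => ?_
  rw [WithLp.ofLp_smul, AxialQuad.eval_pderiv_of_isHomogeneous_two hP, Complex.ofReal_sum, Finset.sum_smul,
    Finset.sum_comm]
  refine Finset.sum_congr rfl fun j _ => ?_
  rw [Complex.ofReal_mul, hπ j, Finset.mul_sum, Finset.sum_smul]
  refine Finset.sum_congr rfl fun b _ => ?_
  rw [dotProduct_comm]

end Coefficients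

/-! ## Reality: a real two-point test family -/

section Reality

/-- The two-point family `δ_{e₀} e₁ + δ_{-e₀} e₁` is realised at level `N ≥ 1`: some level-`N`
field has `û(±e₀) = e₁` (as complex vectors). [folklore] -/
theorem exists_isLevel_coef_axis {N : ℕ} (hN : 1 ≤ N) :
    ∃ u : Torus.energySpace (Fin 3), IsLevel N u ∧
      WithLp.ofLp (coef u ![1, 0, 0]) = ![0, 1, 0] ∧ WithLp.ofLp (coef u (-![1, 0, 0])) = ![0, 1, 0] := by
  set v : EuclideanSpace ℝ (Fin 3) := EuclideanSpace.single 1 1 with hv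
  set c : (Fin 3 → ℤ) → EuclideanSpace ℂ (Fin 3) :=
    Pi.single ![1, 0, 0] ((1 : ℂ) • EuclideanSpace.complexify v) +
      Pi.single (-![1, 0, 0]) (conj (1 : ℂ) • EuclideanSpace.complexify v) with hc
  have hmem : (![1, 0, 0] : Fin 3 → ℤ) ∈ (Torus.freqBall N).erase 0 := by
    rw [AxialQuad.mem_ball_iff]
    refine ⟨fun h => by simpa using congr_fun h 0, ?_⟩
    simp only [vec3_dotProduct, Matrix.cons_val_zero, Matrix.cons_val_one, Matrix.cons_val_two, Matrix.tail_cons,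
      Matrix.head_cons, mul_zero, add_zero, mul_one]
    have : (1 : ℤ) ≤ N := by exact_mod_cast hN
    nlinarith
  have hmem' : (-![1, 0, 0] : Fin 3 → ℤ) ∈ (Torus.freqBall N).erase 0 := neg_mem_freqBall_erase_zero _ hmem
  have hcs : Torus.IsConjSymm c := isConjSymm_single_add_single _ _ _
  have hT : Torus.IsTransversal ((Torus.freqBall N).erase 0) c :=
    isTransversal_single_add_single _ _ (by simp [hv])
  have hsupp : ∀ k ∉ (Torus.freqBall N).erase (0 : Fin 3 → ℤ), c k = 0 := by
    intro k hk
    have h1 : k ≠ ![1, 0, 0] := fun h => hk (h ▸ hmem)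
    have hmem'' : (![-1, 0, 0] : Fin 3 → ℤ) ∈ (Torus.freqBall N).erase 0 := by
      convert hmem' using 1; ext i; fin_cases i <;> simp
    have h2 : k ≠ ![-1, 0, 0] := fun h => hk (h ▸ hmem'')
    simp [hc, Pi.single_eq_of_ne h1, Pi.single_eq_of_ne h2]
  obtain ⟨u, hu, hcoef, -⟩ := exists_isLevel_coef_eq N c hcs hT hsupp
  have hne : (-![1, 0, 0] : Fin 3 → ℤ) ≠ ![1, 0, 0] := fun h => by simpa using congr_fun h 0
  have hcv : WithLp.ofLp ((1 : ℂ) • EuclideanSpace.complexify v) = ![0, 1, 0] := by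
    funext i
    fin_cases i <;> simp [hv, EuclideanSpace.complexify]
  refine ⟨u, hu, ?_, ?_⟩
  · rw [hcoef, hc, Pi.add_apply, Pi.single_eq_same, Pi.single_eq_of_ne hne.symm, add_zero, hcv]
  · rw [hcoef, hc, Pi.add_apply, Pi.single_eq_of_ne hne, Pi.single_eq_same, zero_add, map_one, hcv]

/-- If `α e₁ + β e₂` and `α e₁ - β e₂` are conjugate vectors then `α` is real and `β` is imaginary.
[folklore] -/
theorem real_of_conj_axis {α β : ℂ} {T T' : Fin 3 → ℂ}
    (hT : T = α • ![0, 1, 0] + β • ((fun i : Fin 3 => (((![1, 0, 0] : Fin 3 → ℤ) i : ℤ) : ℂ)) ⨯₃ ![0, 1, 0]))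
    (hT' : T' = α • ![0, 1, 0] + β • ((fun i : Fin 3 => ((((-![1, 0, 0]) : Fin 3 → ℤ) i : ℤ) : ℂ)) ⨯₃ ![0, 1, 0]))
    (hconj : ∀ i, T' i = conj (T i)) : conj α = α ∧ conj β = -β := by
  have h1 := hconj 1
  have h2 := hconj 2
  rw [hT, hT'] at h1 h2
  simp [cross_apply] at h1 h2
  exact ⟨h1.symm, by rw [h2.symm.trans (by ring : -β = -β)]⟩

end Reality


/-- `β` with `conj β = -β` is `i · Im β`; the normalisation used for the curl coefficient. [folklore] -/
theorem curl_normalisation {β : ℂ} (hβ : conj β = -β) :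
    (((2 * (β.im / (4 * Real.pi)) : ℝ) : ℂ) * (2 * Real.pi * Complex.I)) = β := by
  have hre : β.re = 0 := by
    have := congrArg Complex.re hβ
    simp at this
    linarith
  have hβI : β = (β.im : ℂ) * Complex.I := Complex.ext (by simp [hre]) (by simp)
  have hr : (2 * (β.im / (4 * Real.pi)) * (2 * Real.pi) : ℝ) = β.im := by
    field_simp
    ring
  calc (((2 * (β.im / (4 * Real.pi)) : ℝ) : ℂ) * (2 * Real.pi * Complex.I))
        = (((2 * (β.im / (4 * Real.pi)) * (2 * Real.pi) : ℝ)) : ℂ) * Complex.I := by push_cast; ring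
    _ = β := by rw [hr]; exact hβI.symm


end

end Summit.AnomalousDissipation.AnomalousDissipation.Theorems.MomentParityQuarticGate.AxialQuad

/-! ## The stub -/

namespace Summit.AnomalousDissipation.AnomalousDissipation.Theorems.MomentParityQuarticGate

open scoped InnerProductSpace ComplexConjugate
open Matrix
open Literature.Analysis.FunctionSpaces Literature.Analysis.FluidPDE
open Summit.AnomalousDissipation.AnomalousDissipation.Theorems.QuarticGate.Negative

-- the summit-side namespace repeats `AnomalousDissipation` by the tree's convention
set_option linter.dupNamespace false

noncomputable section

set_option maxHeartbeats 1600000 in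
-- one long assembly
/-- **AXIAL QUADRATIC RIGIDITY** (stub S2q `stub_axialQuadRigidity` of line `axis-sectors`, crux
`MomentParity.QuarticGate`): for band tests `g` at level
`N ≥ 2`, a homogeneous quadratic `P`, `AxialObs`-invariance with `L > 2N` and the Casimir clause,
`∇p(u) = 2α P_N u + 2β curl P_N u` on level-`N` fields for real constants `α, β`. [folklore] -/
theorem stub_axialQuadRigidity : ∀ N : ℕ, 2 ≤ N → ∀ L : ℕ, 2 * N < L →
    ∀ (m : ℕ) (g : Fin m → UnitAddTorus (Fin 3) → EuclideanSpace ℝ (Fin 3))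
      (P : MvPolynomial (Fin m) ℝ), (∀ i, IsBandTest N (g i)) → P.IsHomogeneous 2 →
      (∀ a : UnitAddTorus (Fin 3), a 1 = 0 → L • a = 0 → ∀ u : Torus.energySpace (Fin 3), IsLevel N u →
        MvPolynomial.eval (fun j => Torus.pairing u.1 (fun x => g j (x + a))) P =
          MvPolynomial.eval (fun j => Torus.pairing u.1 (g j)) P) →
      (∀ u : Torus.energySpace (Fin 3), IsLevel N u →
        Torus.nsGeneratorPairing (d := Fin 3) 0 0 u (polyGrad g P u) = 0) →
      ∃ α β : ℝ, ∀ u : Torus.energySpace (Fin 3), IsLevel N u →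
        ∀ x, polyGrad g P u x =
          (2 * α) • Torus.fourierTruncate N (u.1 : UnitAddTorus (Fin 3) → EuclideanSpace ℝ (Fin 3)) x +
          (2 * β) • BDSV.curl (Torus.fourierTruncate N
            (u.1 : UnitAddTorus (Fin 3) → EuclideanSpace ℝ (Fin 3))) x := by
  intro N hN L hL m g P hg hP hObs hCas
  -- Step 1: the algebraic core on the Hessian blocks
  have hsupp : ∀ a b : Fin 3 → ℤ, ¬ (((a : Fin 3 → ℤ) ≠ 0 ∧ (a) ⬝ᵥ (a) ≤ ((N : ℕ) : ℤ) ^ 2) ∧ ((b : Fin 3 → ℤ) ≠ 0 ∧ (b) ⬝ᵥ (b) ≤ ((N : ℕ) : ℤ) ^ 2)) → (∑ i, ∑ j, (((MvPolynomial.pderiv j (MvPolynomial.pderiv i P)).coeff 0 : ℝ) : ℂ) • Matrix.vecMulVec (WithLp.ofLp (tcoef (g i) (-(a)))) (WithLp.ofLp (tcoef (g j) (-(b))))) = 0 := by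
    intro a b h
    apply AxialQuad.hessianBlock_eq_zero_of_not_mem g P hg
    by_contra h'
    push Not at h'
    exact h ⟨(AxialQuad.mem_ball_iff a).1 h'.1, (AxialQuad.mem_ball_iff b).1 h'.2⟩
  obtain ⟨α, β, hcore⟩ := AxialQuad.axialQuad_core hN (fun a b => (∑ i, ∑ j, (((MvPolynomial.pderiv j (MvPolynomial.pderiv i P)).coeff 0 : ℝ) : ℂ) • Matrix.vecMulVec (WithLp.ofLp (tcoef (g i) (-(a)))) (WithLp.ofLp (tcoef (g j) (-(b)))))) hsupp
    (fun a b => AxialQuad.hessianBlock_transpose g P a b) (AxialQuad.hessianBlock_row g P hg) (AxialQuad.hessianBlock_col g P hg)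
    (fun a b => AxialQuad.axial_of_axialObs hL g hg P hP hObs a b)
    (fun k₁ k₂ k₃ v₁ v₂ v₃ => AxialQuad.pol_of_casimir g hg P hP hCas k₁ k₂ k₃ v₁ v₂ v₃)
  -- Step 2: the coefficient identity `𝓕(∇p(u))(k) = α û(k) + β k × û(k)`
  have hcoefId : ∀ u : Torus.energySpace (Fin 3), IsLevel N u → ∀ k : Fin 3 → ℤ,
      WithLp.ofLp (tcoef (polyGrad g P u) k) =
        α • WithLp.ofLp (coef u k) + β • ((fun i : Fin 3 => (((k : Fin 3 → ℤ) i : ℤ) : ℂ)) ⨯₃ WithLp.ofLp (coef u k)) := by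
    intro u hu k
    rw [AxialQuad.tcoef_polyGrad_eq_sum_blocks g P hg hP u k]
    have hterm : ∀ b ∈ (Torus.freqBall N).erase 0, (∑ i, ∑ j, (((MvPolynomial.pderiv j (MvPolynomial.pderiv i P)).coeff 0 : ℝ) : ℂ) • Matrix.vecMulVec (WithLp.ofLp (tcoef (g i) (-(-k)))) (WithLp.ofLp (tcoef (g j) (-(b))))) *ᵥ WithLp.ofLp (coef u b) =
        if b = k then α • WithLp.ofLp (coef u k) + β • ((fun i : Fin 3 => (((k : Fin 3 → ℤ) i : ℤ) : ℂ)) ⨯₃ WithLp.ofLp (coef u k)) else 0 := by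
      intro b hb
      have hy : WithLp.ofLp (coef u b) ⬝ᵥ (fun i : Fin 3 => (((b : Fin 3 → ℤ) i : ℤ) : ℂ)) = 0 := by
        rw [dotProduct, ← sum_mul_coef_eq_zero u b]
        exact Finset.sum_congr rfl fun j _ => mul_comm _ _
      rw [hcore (-k) b _ hy]
      by_cases hbk : b = k
      · subst hbk
        rw [if_pos ⟨neg_add_cancel b, (AxialQuad.mem_ball_iff b).1 hb⟩, if_pos rfl]
      · rw [if_neg (fun h => hbk (neg_add_eq_zero.1 h.1).symm), if_neg hbk]
    rw [Finset.sum_congr rfl hterm, Finset.sum_ite_eq']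
    split_ifs with hk
    · rfl
    · rw [coef_eq_zero_of_not_mem hu hk, WithLp.ofLp_zero, map_zero, smul_zero, smul_zero, add_zero]
  -- Step 3: reality of `α`, imaginarity of `β`
  have hN1 : 1 ≤ N := by omega
  obtain ⟨u₀, hu₀, hc₀, hc₀'⟩ := AxialQuad.exists_isLevel_coef_axis hN1
  have hTcs : Torus.IsConjSymm (tcoef (polyGrad g P u₀)) :=
    isConjSymm_tcoef (isSmooth_polyGrad g P u₀ (fun i => (hg i).1)).continuous.integrable_unitAddTorus
  have hreal : conj α = α ∧ conj β = -β := by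
    refine AxialQuad.real_of_conj_axis (T := WithLp.ofLp (tcoef (polyGrad g P u₀) ![1, 0, 0]))
      (T' := WithLp.ofLp (tcoef (polyGrad g P u₀) (-![1, 0, 0]))) ?_ ?_ ?_
    · rw [hcoefId u₀ hu₀, hc₀]
    · rw [hcoefId u₀ hu₀, hc₀']
    · intro i
      rw [hTcs]
      rfl
  have hα : (((2 * (α.re / 2) : ℝ)) : ℂ) = α := by
    push_cast
    rw [mul_div_cancel₀ _ (two_ne_zero' ℂ)]
    exact Complex.conj_eq_iff_re.1 hreal.1
  have hβ := AxialQuad.curl_normalisation hreal.2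
  -- Step 4: synthesis
  refine ⟨α.re / 2, β.im / (4 * Real.pi), fun u hu x => ?_⟩
  have hfun : tcoef (polyGrad g P u) = fun k => (((2 * (α.re / 2) : ℝ)) : ℂ) • coef u k +
      (((2 * (β.im / (4 * Real.pi)) : ℝ)) : ℂ) • IntermittentBeltrami.curlCoeff (coef u) k := by
    funext k
    ext i
    have h := congr_fun (hcoefId u hu k) i
    simp only [Pi.add_apply, Pi.smul_apply, smul_eq_mul] at h
    rw [PiLp.add_apply, PiLp.smul_apply, PiLp.smul_apply, IntermittentBeltrami.curlCoeff_apply, smul_eq_mul,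
      smul_eq_mul, ← mul_assoc, hβ, hα]
    exact h
  have hsm := isSmooth_polyGrad g P u (fun i => (hg i).1)
  have hPG : Torus.fourierTruncate N (polyGrad g P u) = polyGrad g P u :=
    Torus.fourierTruncate_eq_self hsm.continuous fun k hk =>
      tcoef_polyGrad_eq_zero g P u hg fun hmem =>
        not_le.2 hk (Torus.mem_freqBall.1 (Finset.mem_of_mem_erase hmem))
  rw [← hPG, show Torus.fourierTruncate N (polyGrad g P u) =
    Torus.realTrigPoly (Torus.freqBall N) (tcoef (polyGrad g P u)) from rfl, hfun,
    show (fun k => (((2 * (α.re / 2) : ℝ)) : ℂ) • coef u k +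
      (((2 * (β.im / (4 * Real.pi)) : ℝ)) : ℂ) • IntermittentBeltrami.curlCoeff (coef u) k) =
      (fun k => (((2 * (α.re / 2) : ℝ)) : ℂ) • coef u k) +
        (fun k => (((2 * (β.im / (4 * Real.pi)) : ℝ)) : ℂ) • IntermittentBeltrami.curlCoeff (coef u) k) from rfl,
    Torus.realTrigPoly_add, Pi.add_apply, IntermittentBeltrami.realTrigPoly_ofReal_smul,
    IntermittentBeltrami.realTrigPoly_ofReal_smul, ← IntermittentBeltrami.curl_realTrigPoly]
  rfl


/-- **Registered sub-goal `axialQuadRigidity_main` of stub S2q**: the same rigidity with the constants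
renormalised (`∇p(u) = α P_N u + β curl P_N u`). [folklore] -/
theorem axialQuadRigidity_main : ∀ N : ℕ, 2 ≤ N → ∀ L : ℕ, 2 * N < L →
    ∀ (m : ℕ) (g : Fin m → UnitAddTorus (Fin 3) → EuclideanSpace ℝ (Fin 3))
      (P : MvPolynomial (Fin m) ℝ), (∀ i, IsBandTest N (g i)) → P.IsHomogeneous 2 →
      (∀ a : UnitAddTorus (Fin 3), a 1 = 0 → L • a = 0 → ∀ u : Torus.energySpace (Fin 3), IsLevel N u →
        MvPolynomial.eval (fun j => Torus.pairing u.1 (fun x => g j (x + a))) P =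
          MvPolynomial.eval (fun j => Torus.pairing u.1 (g j)) P) →
      (∀ u : Torus.energySpace (Fin 3), IsLevel N u →
        Torus.nsGeneratorPairing 0 (0 : UnitAddTorus (Fin 3) → EuclideanSpace ℝ (Fin 3)) u (polyGrad g P u) = 0) →
      ∃ α β : ℝ, ∀ u : Torus.energySpace (Fin 3), IsLevel N u →
        ∀ x, polyGrad g P u x =
          α • Torus.fourierTruncate N (u.1 : UnitAddTorus (Fin 3) → EuclideanSpace ℝ (Fin 3)) x +
          β • BDSV.curl (Torus.fourierTruncate N
            (u.1 : UnitAddTorus (Fin 3) → EuclideanSpace ℝ (Fin 3))) x := by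
  intro N hN L hL m g P hg hP hObs hCas
  obtain ⟨α, β, h⟩ := stub_axialQuadRigidity N hN L hL m g P hg hP hObs hCas
  exact ⟨2 * α, 2 * β, h⟩

end

end Summit.AnomalousDissipation.AnomalousDissipation.Theorems.MomentParityQuarticGate
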